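import Summits.ABC.ABC.Theorems.IsogenyGlueCongruenceEllipticGluingPrimeBoundSimpleOfBound
import Literature.NumberTheory.EllipticCurves.NonEisensteinPrimeOfSurjective
import Literature.AlgebraicGeometry.Motives.AbelianVarietyEndGaloisDescent
import HarnessLib

/-!
# Crux U `EllipticGluingPrimeBound` (stmt-ABC-13919), line `SketchIdeator5` — the two residual
# stubs are NECESSARY: `U_simple ⟹ R_gen`, `U_simple ⟹ R_cm`, hence `U ⟹ R_gen ∧ R_cm`

Line `SketchIdeator5` (slices of the free branch `U_simple`; skeleton
`Cruxes/EllipticGluingPrimeBound/Lines/SketchIdeator5.lean`) assembles `U_simple` — height-free,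
dimension-polynomial torsion sharing `W[ℓ] ↪ A(ℚ̄)` with ℚ-simple, geometrically `E`-free partners —
from two RESIDUAL stubs:

* `stub_genericPartnerBound` (R_gen): non-CM `W`, primes `ℓ ≥ 5` of surjective `ρ̄_{W,ℓ}`, partners
  over whose endomorphism field the congruence is FULL (every commutator automorphism of `W[ℓ]`
  is `ρ̄_{W,ℓ}(σ)` for a `σ` fixing all geometric endomorphisms of `A`);
* `stub_cmCurvePartnerBound` (R_cm): CM curves `W`.

This file records the converse bookkeeping: both residuals are WEAKENINGS of `U_simple` (they only
add hypotheses; for R_gen, surjectivity of `ρ̄_{W,ℓ}` gives the irreducibility `U_simple` asks for,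
`hasIrreducibleModPGaloisRep_of_hasSurjectiveModNGaloisRep`), and `U ⟹ U_simple` is the landed
UNCONDITIONAL converse `simpleFreeTorsionBound_of_ellipticGluingPrimeBound` (p117529).  Hence every
proof of the crux contains proofs of R_gen and R_cm: the residuals into which the line is exhausted
are crux-necessary, not artefacts of the slicing.  Standard axioms, no named facts, no definitions,
no `sorry`; lands `--supports stmt-ABC-13919`.
-/

noncomputable section

-- `Summit.<Summit>.<Problem>` is the mandated summit-side namespace (CONVENTIONS §2); for the
-- single-conjunct summit `ABC` the two coincide, so the duplicate `ABC.ABC` is deliberate.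
set_option linter.dupNamespace false

namespace Summit.ABC.ABC.Theorems.GluingSlices

open CategoryTheory CategoryTheory.Limits AlgebraicGeometry
open Literature.AlgebraicGeometry.Motives
open Summit.ABC.ABC.Theses.IsogenyGlueCongruence
open Summit.ABC.ABC.Theorems.IsotypicMinkowski

/-- **`U_simple ⟹ R_gen`.** The generic residual `stub_genericPartnerBound` of line `SketchIdeator5`
is a weakening of `U_simple`: its extra hypotheses (non-CM, `ℓ ≥ 5`, fullness over the endomorphism
field) are simply dropped, and surjectivity of `ρ̄_{W,ℓ}` implies the irreducibility of `W[ℓ]` that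
`U_simple` requires. -/
theorem genericPartnerBound_of_simpleFreeTorsionBound
    (hS : ∃ κ C : ℝ, 0 ≤ κ ∧ ∀ (W : WeierstrassCurve ℚ) [W.IsElliptic] (E A : AbelianVariety.{0} ℚ)
      (e : E.geomPoints ≃+ W.geomPoints),
      (∀ (σ : Field.absoluteGaloisGroup ℚ) (P : E.geomPoints), e (σ • P) = σ • e P) →
      (∀ f : E.baseChange (AlgebraicClosure ℚ) ⟶ A.baseChange (AlgebraicClosure ℚ), f = 0) →
      AbelianVariety.IsSimple A →
      ∀ ℓ : ℕ, ℓ.Prime → W.HasIrreducibleModPGaloisRep ℓ →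
      (∃ ι : W.geomTorsion ℓ →+ A.geomPoints, Function.Injective ι ∧
        ∀ (σ : Field.absoluteGaloisGroup ℚ) (P : W.geomTorsion ℓ), ι (σ • P) = σ • ι P) →
        (ℓ : ℝ) ≤ C * (((A.dim : ℝ) + 1) * max 1 W.stableFaltingsHeight) ^ κ) :
    ∃ κ C : ℝ, 0 ≤ κ ∧ ∀ (W : WeierstrassCurve ℚ) [W.IsElliptic] (E A : AbelianVariety.{0} ℚ)
      (e : E.geomPoints ≃+ W.geomPoints),
      (∀ (σ : Field.absoluteGaloisGroup ℚ) (P : E.geomPoints), e (σ • P) = σ • e P) →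
      (∀ f : E.baseChange (AlgebraicClosure ℚ) ⟶ A.baseChange (AlgebraicClosure ℚ), f = 0) →
      AbelianVariety.IsSimple A → ¬ W.HasCM →
      ∀ ℓ : ℕ, ℓ.Prime → 5 ≤ ℓ → W.HasSurjectiveModNGaloisRep ℓ →
      (∀ g ∈ commutator (Multiplicative (AddAut (W.geomTorsion ℓ))),
        ∃ σ : Field.absoluteGaloisGroup ℚ,
          (∀ r : A.baseChange (AlgebraicClosure ℚ) ⟶ A.baseChange (AlgebraicClosure ℚ),
            A.galConj (AlgebraicClosure ℚ) (Field.absoluteGaloisGroup.toAlgEquiv ℚ σ) r = r) ∧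
          W.galoisRepTorsion ℓ σ = g) →
      (∃ ι : W.geomTorsion ℓ →+ A.geomPoints, Function.Injective ι ∧
        ∀ (σ : Field.absoluteGaloisGroup ℚ) (P : W.geomTorsion ℓ), ι (σ • P) = σ • ι P) →
        (ℓ : ℝ) ≤ C * (((A.dim : ℝ) + 1) * max 1 W.stableFaltingsHeight) ^ κ := by
  obtain ⟨κ, C, hκ, h⟩ := hS
  refine ⟨κ, C, hκ, ?_⟩
  intro W _ E A e he hfree hsimp _ ℓ hℓ _ hsurj _ hι
  haveI : Fact ℓ.Prime := ⟨hℓ⟩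
  exact h W E A e he hfree hsimp ℓ hℓ
    (Literature.NumberTheory.EllipticCurves.hasIrreducibleModPGaloisRep_of_hasSurjectiveModNGaloisRep
      W ℓ hsurj) hι

/-- **`U_simple ⟹ R_cm`.** The CM residual `stub_cmCurvePartnerBound` of line `SketchIdeator5` is
`U_simple` restricted to CM curves `W`. -/
theorem cmCurvePartnerBound_of_simpleFreeTorsionBound
    (hS : ∃ κ C : ℝ, 0 ≤ κ ∧ ∀ (W : WeierstrassCurve ℚ) [W.IsElliptic] (E A : AbelianVariety.{0} ℚ)
      (e : E.geomPoints ≃+ W.geomPoints),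
      (∀ (σ : Field.absoluteGaloisGroup ℚ) (P : E.geomPoints), e (σ • P) = σ • e P) →
      (∀ f : E.baseChange (AlgebraicClosure ℚ) ⟶ A.baseChange (AlgebraicClosure ℚ), f = 0) →
      AbelianVariety.IsSimple A →
      ∀ ℓ : ℕ, ℓ.Prime → W.HasIrreducibleModPGaloisRep ℓ →
      (∃ ι : W.geomTorsion ℓ →+ A.geomPoints, Function.Injective ι ∧
        ∀ (σ : Field.absoluteGaloisGroup ℚ) (P : W.geomTorsion ℓ), ι (σ • P) = σ • ι P) →
        (ℓ : ℝ) ≤ C * (((A.dim : ℝ) + 1) * max 1 W.stableFaltingsHeight) ^ κ) :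
    ∃ κ C : ℝ, 0 ≤ κ ∧ ∀ (W : WeierstrassCurve ℚ) [W.IsElliptic] (E A : AbelianVariety.{0} ℚ)
      (e : E.geomPoints ≃+ W.geomPoints),
      (∀ (σ : Field.absoluteGaloisGroup ℚ) (P : E.geomPoints), e (σ • P) = σ • e P) →
      (∀ f : E.baseChange (AlgebraicClosure ℚ) ⟶ A.baseChange (AlgebraicClosure ℚ), f = 0) →
      AbelianVariety.IsSimple A →
      ∀ ℓ : ℕ, ℓ.Prime → W.HasIrreducibleModPGaloisRep ℓ → W.HasCM →
      (∃ ι : W.geomTorsion ℓ →+ A.geomPoints, Function.Injective ι ∧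
        ∀ (σ : Field.absoluteGaloisGroup ℚ) (P : W.geomTorsion ℓ), ι (σ • P) = σ • ι P) →
        (ℓ : ℝ) ≤ C * (((A.dim : ℝ) + 1) * max 1 W.stableFaltingsHeight) ^ κ := by
  obtain ⟨κ, C, hκ, h⟩ := hS
  exact ⟨κ, C, hκ, fun W _ E A e he hfree hsimp ℓ hℓ hirr _ hι ↦ h W E A e he hfree hsimp ℓ hℓ hirr hι⟩

/-- **`U ⟹ R_gen`** (unconditional): the crux implies the generic residual of line
`SketchIdeator5`, through `U ⟹ U_simple` (`simpleFreeTorsionBound_of_ellipticGluingPrimeBound`,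
p117529) and `genericPartnerBound_of_simpleFreeTorsionBound`. -/
theorem genericPartnerBound_of_ellipticGluingPrimeBound :
    EllipticGluingPrimeBound → ∃ κ C : ℝ, 0 ≤ κ ∧ ∀ (W : WeierstrassCurve ℚ) [W.IsElliptic] (E A : AbelianVariety.{0} ℚ)
      (e : E.geomPoints ≃+ W.geomPoints),
      (∀ (σ : Field.absoluteGaloisGroup ℚ) (P : E.geomPoints), e (σ • P) = σ • e P) →
      (∀ f : E.baseChange (AlgebraicClosure ℚ) ⟶ A.baseChange (AlgebraicClosure ℚ), f = 0) →
      AbelianVariety.IsSimple A → ¬ W.HasCM →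
      ∀ ℓ : ℕ, ℓ.Prime → 5 ≤ ℓ → W.HasSurjectiveModNGaloisRep ℓ →
      (∀ g ∈ commutator (Multiplicative (AddAut (W.geomTorsion ℓ))),
        ∃ σ : Field.absoluteGaloisGroup ℚ,
          (∀ r : A.baseChange (AlgebraicClosure ℚ) ⟶ A.baseChange (AlgebraicClosure ℚ),
            A.galConj (AlgebraicClosure ℚ) (Field.absoluteGaloisGroup.toAlgEquiv ℚ σ) r = r) ∧
          W.galoisRepTorsion ℓ σ = g) →
      (∃ ι : W.geomTorsion ℓ →+ A.geomPoints, Function.Injective ι ∧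
        ∀ (σ : Field.absoluteGaloisGroup ℚ) (P : W.geomTorsion ℓ), ι (σ • P) = σ • ι P) →
        (ℓ : ℝ) ≤ C * (((A.dim : ℝ) + 1) * max 1 W.stableFaltingsHeight) ^ κ :=
  fun hU ↦
  genericPartnerBound_of_simpleFreeTorsionBound (simpleFreeTorsionBound_of_ellipticGluingPrimeBound hU)

/-- **`U ⟹ R_cm`** (unconditional): the crux implies the CM residual of line `SketchIdeator5`,
through `U ⟹ U_simple` (p117529) and `cmCurvePartnerBound_of_simpleFreeTorsionBound`. -/
theorem cmCurvePartnerBound_of_ellipticGluingPrimeBound :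
    EllipticGluingPrimeBound → ∃ κ C : ℝ, 0 ≤ κ ∧ ∀ (W : WeierstrassCurve ℚ) [W.IsElliptic] (E A : AbelianVariety.{0} ℚ)
      (e : E.geomPoints ≃+ W.geomPoints),
      (∀ (σ : Field.absoluteGaloisGroup ℚ) (P : E.geomPoints), e (σ • P) = σ • e P) →
      (∀ f : E.baseChange (AlgebraicClosure ℚ) ⟶ A.baseChange (AlgebraicClosure ℚ), f = 0) →
      AbelianVariety.IsSimple A →
      ∀ ℓ : ℕ, ℓ.Prime → W.HasIrreducibleModPGaloisRep ℓ → W.HasCM →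
      (∃ ι : W.geomTorsion ℓ →+ A.geomPoints, Function.Injective ι ∧
        ∀ (σ : Field.absoluteGaloisGroup ℚ) (P : W.geomTorsion ℓ), ι (σ • P) = σ • ι P) →
        (ℓ : ℝ) ≤ C * (((A.dim : ℝ) + 1) * max 1 W.stableFaltingsHeight) ^ κ :=
  fun hU ↦
  cmCurvePartnerBound_of_simpleFreeTorsionBound (simpleFreeTorsionBound_of_ellipticGluingPrimeBound hU)

end Summit.ABC.ABC.Theorems.GluingSlices

end
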